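import HarnessLib
import Mathlib.RingTheory.MvPolynomial.WeightedHomogeneous
import Mathlib.LinearAlgebra.Matrix.Charpoly.Coeff
import Mathlib.Data.Nat.Sqrt
import Mathlib.Data.Complex.Basic
import Literature.LinearAlgebra.Matrix.FaddeevLeVerrier

/-!
# Depth4SymWidthNewtonGirard — bundled Newton–Girard bookkeeping for the symmetric width door
(O30-C, decomp-valiant lens 4 «depth-reduction / chasm axis», generation 39; file 1 of 2)

HONEST BOUNDARY.  Power-sum / trace bookkeeping only: `VP ≠ VNP` is untouched, no route item is
closed, nothing is claimed for the width door of record.  This file supplies, for the companion file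
`Depth4SymWidthDet` (the determinant's square-symmetric composition at door parameters), two things.

(1) DET AS A WEIGHTED-HOMOGENEOUS POLYNOMIAL IN TRACES OF POWERS
(`exists_isWeightedHomogeneous_aeval_trace_eq_det`).  For a square matrix `M` over a commutative
`ℂ`-algebra with `N = Fintype.card m` there is `G ∈ ℂ[p₁, p₂, …]` (variables indexed by `ℕ`, the
variable `i` standing for `pᵢ₊₁ = tr M^{i+1}` and carrying weight `i + 1`), weighted-homogeneous of
weight `N`, with `G(tr M, tr M², …) = det M`.  This is the cycle-index (bundled Newton–Girard) formula
`det M = Σ_{λ ⊢ N} (−1)^{N−ℓ(λ)} z_λ⁻¹ Π_i tr M^{λ_i}`; we do not expand it but obtain `G` by descending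
induction on the coefficients of the characteristic polynomial from the TRACE FORM OF NEWTON'S IDENTITY
`(N − l)·c_l = −Σ_{k>l} c_k · tr M^{k−l}` (`newton_trace`), which is read off the tree's Faddeev–LeVerrier
file (`Literature.LinearAlgebra.Matrix.sub_mul_charpoly_coeff`, `flMat`; [cite: Altac2024, eq. (4), (8)]),
dividing by `N − l ≠ 0` in characteristic `0`; then `det M = (−1)^N c_0`
(`Matrix.det_eq_sign_charpoly_coeff`).  Every monomial `Π pₐ^{mₐ}` of `G` has `Σ a·mₐ = N` — this is
the only property of `G` the door construction uses.

(2) DEGREE ACCOUNTING (`mul_letterCost_le`, `sum_letterCost_le_door`; the cost expression is kept inline, no definition).  With `s = ⌊√n⌋` the companion file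
realises the power sum `pₐ^{m}` (`a = m' + 1` below) by a word of total degree `cost s m' m` in
letters of degree `≤ s`: for a part `a > s` the cost is `m·(⌊a/s⌋ + 1)` (so `s·cost ≤ 2a·m`), for a
bundled part `a ≤ s` it is `⌊m/k⌋ + 1` with `k = ⌊s/a⌋ ≥ 1` (so `s·cost ≤ 2a·m + s`).  Summing over a
monomial of weight `n`: `s·Σcost ≤ 2n + s²`, and with `n < (s+1)²` this gives `Σcost ≤ 3s + 4`; the
bound recorded (with slack, matching the door dial `c = 7`) is `Σcost ≤ 7s + 7`.  Generic total-degree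
lemmas for entries of products / powers / traces of matrices of polynomials are included.

References: [cite: Altac2024] (Faddeev–LeVerrier / Newton trace identities, via the tree file);
Dawar–Pago–Seppelt, *Symmetric algebraic complexity classes*, arXiv:2601.09343, Outlook «Symmetric depth
reductions» (p. 12) — the question this calibration speaks to; [cite: DawarWilsenach2025] (the symmetric
circuit model of the companion file's door).
-/

set_option linter.dupNamespace false

namespace Summit.ValiantsHypothesis.ValiantsHypothesis.Theorems.Depth4SymWidthDoor

open MvPolynomial Finset

/-! ## (1) Newton's identity in trace form and the bundled Newton–Girard polynomial -/

section NewtonGirard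

variable {A : Type*} [CommRing A] {m : Type*} [Fintype m] [DecidableEq m]

/-- NEWTON'S IDENTITY, trace form, from the tree's Faddeev–LeVerrier recursion: with
`c_l = M.charpoly.coeff l` and `N = Fintype.card m`, for `l < N`,
`(N − l)·c_l = −Σ_{l<k≤N} c_k · tr M^{k−l}`. -/
theorem newton_trace (M : Matrix m m A) {l : ℕ} (hl : l < Fintype.card m) :
    ((Fintype.card m - l : ℕ) : A) * M.charpoly.coeff l =
      -∑ k ∈ range (Fintype.card m + 1),
        (if l < k then M.charpoly.coeff k * (M ^ (k - l)).trace else 0) := by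
  rw [Literature.LinearAlgebra.Matrix.sub_mul_charpoly_coeff M hl,
    Literature.LinearAlgebra.Matrix.flMat, Finset.mul_sum, Matrix.trace_sum]
  congr 1
  refine Finset.sum_congr rfl fun k _ => ?_
  split_ifs with hlk
  · rw [Matrix.mul_smul, Matrix.trace_smul, smul_eq_mul, ← pow_succ',
      show k - (l + 1) + 1 = k - l by omega]
  · rw [Matrix.mul_zero, Matrix.trace_zero]

variable [Algebra ℂ A] [Nontrivial A]

/-- BUNDLED NEWTON–GIRARD, coefficient form: every coefficient `c_l` of the characteristic polynomial
is `H_l(tr M, tr M², …)` for a polynomial `H_l ∈ ℂ[p₁, p₂, …]` (variable `i` ↦ `tr M^{i+1}`, weight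
`i + 1`) that is weighted-homogeneous of weight `N − l`.  Descending induction on `l` from `c_N = 1`,
dividing Newton's identity by `N − l` (characteristic `0`). -/
theorem exists_isWeightedHomogeneous_aeval_trace_eq_charpoly_coeff (M : Matrix m m A) :
    ∃ H : ℕ → MvPolynomial ℕ ℂ, ∀ l, l ≤ Fintype.card m →
      IsWeightedHomogeneous (fun i : ℕ => i + 1) (H l) (Fintype.card m - l) ∧
      aeval (fun i : ℕ => (M ^ (i + 1)).trace) (H l) = M.charpoly.coeff l := by
  obtain ⟨N, hN⟩ : ∃ N : ℕ, N = Fintype.card m := ⟨_, rfl⟩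
  rw [← hN]
  -- all indices `l` with `N - d ≤ l ≤ N`, by induction on `d`
  suffices key : ∀ d : ℕ, ∃ H : ℕ → MvPolynomial ℕ ℂ, ∀ l, N - d ≤ l → l ≤ N →
      IsWeightedHomogeneous (fun i : ℕ => i + 1) (H l) (N - l) ∧
      aeval (fun i : ℕ => (M ^ (i + 1)).trace) (H l) = M.charpoly.coeff l by
    obtain ⟨H, hH⟩ := key N
    exact ⟨H, fun l hl => hH l (by omega) hl⟩
  intro d
  induction d with
  | zero =>
    refine ⟨fun _ => 1, fun l hl hlN => ?_⟩
    obtain rfl : l = N := le_antisymm hlN (by simpa using hl)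
    refine ⟨by rw [Nat.sub_self]; exact isWeightedHomogeneous_one ℂ _, ?_⟩
    have h := M.charpoly_monic.coeff_natDegree
    rw [Matrix.charpoly_natDegree_eq_dim, ← hN] at h
    rw [map_one, h]
  | succ d ih =>
    obtain ⟨H, hH⟩ := ih
    by_cases hd : N ≤ d
    · exact ⟨H, fun l hl hlN => hH l (by omega) hlN⟩
    obtain ⟨l₀, hl₀⟩ : ∃ l₀ : ℕ, l₀ = N - (d + 1) := ⟨_, rfl⟩
    have hl₀N : l₀ < N := by omega
    obtain ⟨P, hP⟩ : ∃ P : MvPolynomial ℕ ℂ, P = C (-(1 / ((N - l₀ : ℕ) : ℂ))) *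
        ∑ k ∈ range (N + 1), (if l₀ < k then H k * X (k - l₀ - 1) else 0) := ⟨_, rfl⟩
    refine ⟨Function.update H l₀ P, fun l hl hlN => ?_⟩
    by_cases hll : l = l₀
    · rw [hll, Function.update_self, hP]
      refine ⟨IsWeightedHomogeneous.C_mul ?_ _, ?_⟩
      · refine IsWeightedHomogeneous.sum _ _ _ fun k hk => ?_
        have hkN : k ≤ N := by have := Finset.mem_range.1 hk; omega
        split_ifs with hlk
        · rw [show N - l₀ = (N - k) + ((k - l₀ - 1) + 1) by omega]
          exact (hH k (by omega) hkN).1.mul (isWeightedHomogeneous_X ℂ _ _)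
        · exact isWeightedHomogeneous_zero ℂ _ _
      · have hnewt : ((N - l₀ : ℕ) : A) * M.charpoly.coeff l₀ =
            -∑ k ∈ range (N + 1),
              (if l₀ < k then M.charpoly.coeff k * (M ^ (k - l₀)).trace else 0) := by
          rw [hN]; exact newton_trace M (by rw [← hN]; exact hl₀N)
        have hS : aeval (fun i : ℕ => (M ^ (i + 1)).trace)
            (∑ k ∈ range (N + 1), (if l₀ < k then H k * X (k - l₀ - 1) else 0)) =
            ∑ k ∈ range (N + 1),
              (if l₀ < k then M.charpoly.coeff k * (M ^ (k - l₀)).trace else 0) := by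
          rw [map_sum]
          refine Finset.sum_congr rfl fun k hk => ?_
          have hkN : k ≤ N := by have := Finset.mem_range.1 hk; omega
          split_ifs with hlk
          · rw [map_mul, aeval_X, (hH k (by omega) hkN).2,
              show k - l₀ - 1 + 1 = k - l₀ by omega]
          · exact map_zero _
        have hu : ((N - l₀ : ℕ) : ℂ) ≠ 0 := by exact_mod_cast (show N - l₀ ≠ 0 by omega)
        have hS' : (∑ k ∈ range (N + 1),
              (if l₀ < k then M.charpoly.coeff k * (M ^ (k - l₀)).trace else 0)) =
            -(algebraMap ℂ A ((N - l₀ : ℕ) : ℂ) * M.charpoly.coeff l₀) := by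
          rw [map_natCast]; linear_combination hnewt
        rw [map_mul, aeval_C, hS, hS', mul_neg, ← mul_assoc, ← map_mul,
          show -(1 / ((N - l₀ : ℕ) : ℂ)) * ((N - l₀ : ℕ) : ℂ) = -1 by
            rw [neg_mul, one_div, inv_mul_cancel₀ hu],
          map_neg, map_one]
        ring
    · rw [Function.update_of_ne hll]
      exact hH l (by omega) hlN

/-- BUNDLED NEWTON–GIRARD, determinant form (the cycle-index formula, existentially): there is
`G ∈ ℂ[p₁, p₂, …]`, weighted-homogeneous of weight `N = Fintype.card m` for the weights `deg pᵢ = i`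
(variable `i : ℕ` ↦ `pᵢ₊₁`), with `G(tr M, tr M², …) = det M`.  In particular every monomial
`Π pₐ^{mₐ}` of `G` satisfies `Σ a·mₐ = N`. -/
theorem exists_isWeightedHomogeneous_aeval_trace_eq_det (M : Matrix m m A) :
    ∃ G : MvPolynomial ℕ ℂ, IsWeightedHomogeneous (fun i : ℕ => i + 1) G (Fintype.card m) ∧
      aeval (fun i : ℕ => (M ^ (i + 1)).trace) G = M.det := by
  obtain ⟨H, hH⟩ := exists_isWeightedHomogeneous_aeval_trace_eq_charpoly_coeff M
  refine ⟨C ((-1 : ℂ) ^ Fintype.card m) * H 0, ?_, ?_⟩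
  · simpa using ((hH 0 (Nat.zero_le _)).1).C_mul ((-1 : ℂ) ^ Fintype.card m)
  · rw [map_mul, aeval_C, (hH 0 (Nat.zero_le _)).2, Matrix.det_eq_sign_charpoly_coeff, map_pow,
      map_neg, map_one]

end NewtonGirard

/-! ## Total degree of entries of products, powers and traces of polynomial matrices -/

section EntryDegree

variable {R : Type*} [CommSemiring R] {σ ι : Type*} [Fintype ι]

/-- Entries of a product: degrees add. -/
theorem totalDegree_mul_apply_le {P Q : Matrix ι ι (MvPolynomial σ R)} {a b : ℕ}
    (hP : ∀ i j, (P i j).totalDegree ≤ a) (hQ : ∀ i j, (Q i j).totalDegree ≤ b) (i j : ι) :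
    ((P * Q) i j).totalDegree ≤ a + b := by
  rw [Matrix.mul_apply]
  exact totalDegree_finsetSum_le fun k _ =>
    (totalDegree_mul _ _).trans (Nat.add_le_add (hP i k) (hQ k j))

/-- Entries of a `q`-th power have degree `≤ q·a` if the entries have degree `≤ a`. -/
theorem totalDegree_pow_apply_le [DecidableEq ι] {P : Matrix ι ι (MvPolynomial σ R)} {a : ℕ}
    (hP : ∀ i j, (P i j).totalDegree ≤ a) :
    ∀ (q : ℕ) (i j : ι), ((P ^ q) i j).totalDegree ≤ q * a
  | 0, i, j => by
    rw [pow_zero, Matrix.one_apply, zero_mul]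
    split_ifs
    · exact totalDegree_one.le
    · exact totalDegree_zero.le
  | q + 1, i, j => by
    rw [pow_succ, add_mul, one_mul]
    exact totalDegree_mul_apply_le (totalDegree_pow_apply_le hP q) hP i j

/-- The trace has degree `≤ a` if the entries have degree `≤ a`. -/
theorem totalDegree_trace_le {P : Matrix ι ι (MvPolynomial σ R)} {a : ℕ}
    (hP : ∀ i j, (P i j).totalDegree ≤ a) : P.trace.totalDegree ≤ a := by
  unfold Matrix.trace
  exact totalDegree_finsetSum_le fun i _ => hP i i

end EntryDegree

/-! ## (2) Degree accounting for the letter words at `s = ⌊√n⌋` -/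

/-!
COST (total degree in letters of degree `≤ s`) of realising the power `p_{m+1}^μ` of the power sum
`p_{m+1} = tr X^{m+1}` — written INLINE below (no definition is introduced):
`cost s m μ = if s < m + 1 then μ * ((m + 1) / s + 1) else μ / (s / (m + 1)) + 1`;
a part `m + 1 > s` is spelled as the `μ`-th power of a trace word of degree `⌊(m+1)/s⌋ + 1`; a bundled
part `m + 1 ≤ s` uses the letters `(tr X^{m+1})^k`, `k = ⌊s/(m+1)⌋`, and `(tr X^{m+1})^{μ mod k}`, at
degree `⌊μ/k⌋ + 1`.
-/

/-- Per part: `s · cost ≤ 2(m+1)μ (+ s for a bundled part)`. -/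
theorem mul_letterCost_le (s m μ : ℕ) :
    s * (if s < m + 1 then μ * ((m + 1) / s + 1) else μ / (s / (m + 1)) + 1) ≤
      2 * (μ * (m + 1)) + (if m + 1 ≤ s then s else 0) := by
  by_cases h : s < m + 1
  · rw [if_pos h, if_neg (show ¬(m + 1 ≤ s) by omega)]
    have hd : (m + 1) / s * s ≤ m + 1 := Nat.div_mul_le_self _ _
    calc s * (μ * ((m + 1) / s + 1)) = μ * ((m + 1) / s * s + s) := by ring
      _ ≤ μ * ((m + 1) + (m + 1)) := Nat.mul_le_mul_left μ (Nat.add_le_add hd h.le)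
      _ = 2 * (μ * (m + 1)) + 0 := by ring
  · rw [if_neg h, if_pos (show m + 1 ≤ s by omega)]
    obtain ⟨k, hk⟩ : ∃ k : ℕ, k = s / (m + 1) := ⟨_, rfl⟩
    rw [← hk]
    have hk0 : 0 < k := by rw [hk]; exact Nat.div_pos (by omega) (by omega)
    have hs2 : s ≤ 2 * ((m + 1) * k) := by
      have h1 := Nat.div_add_mod s (m + 1)
      have h2 : s % (m + 1) < m + 1 := Nat.mod_lt s (by omega)
      have h3 : m + 1 ≤ (m + 1) * k := Nat.le_mul_of_pos_right _ hk0
      obtain ⟨P, hP⟩ : ∃ P : ℕ, P = (m + 1) * k := ⟨_, rfl⟩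
      rw [← hk, ← hP] at h1
      rw [← hP] at h3 ⊢
      omega
    calc s * (μ / k + 1) = s * (μ / k) + s := by ring
      _ ≤ 2 * ((m + 1) * k) * (μ / k) + s := by gcongr
      _ = 2 * (m + 1) * (k * (μ / k)) + s := by ring
      _ ≤ 2 * (m + 1) * μ + s := by gcongr; exact Nat.mul_div_le μ k
      _ = 2 * (μ * (m + 1)) + s := by ring

/-- Summed over a monomial `d` (exponent `d m` on the part `m + 1`):
`s · Σ cost ≤ 2 · weight(d) + s²`, the weight being `Σ (m+1)·d m`. -/
theorem mul_sum_letterCost_le (s : ℕ) (d : ℕ →₀ ℕ) :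
    s * ∑ m ∈ d.support,
        (if s < m + 1 then d m * ((m + 1) / s + 1) else d m / (s / (m + 1)) + 1) ≤
      2 * Finsupp.weight (fun m : ℕ => m + 1) d + s * s := by
  simp only [Finsupp.weight_apply, Finsupp.sum, smul_eq_mul, Finset.mul_sum]
  calc ∑ m ∈ d.support,
        s * (if s < m + 1 then d m * ((m + 1) / s + 1) else d m / (s / (m + 1)) + 1)
      ≤ ∑ m ∈ d.support, (2 * (d m * (m + 1)) + if m + 1 ≤ s then s else 0) :=
        Finset.sum_le_sum fun m _ => mul_letterCost_le s m (d m)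
    _ = ∑ m ∈ d.support, 2 * (d m * (m + 1)) +
          ∑ m ∈ d.support, (if m + 1 ≤ s then s else 0) := Finset.sum_add_distrib
    _ ≤ ∑ m ∈ d.support, 2 * (d m * (m + 1)) + s * s := by
        gcongr
        rw [Finset.sum_ite, Finset.sum_const_zero, add_zero, Finset.sum_const, smul_eq_mul]
        calc (d.support.filter fun m => m + 1 ≤ s).card * s ≤ (Finset.range s).card * s :=
              Nat.mul_le_mul_right s (Finset.card_le_card fun m hm => by
                rw [Finset.mem_filter] at hm
                exact Finset.mem_range.2 (by omega))
          _ = s * s := by rw [Finset.card_range]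

/-- THE DOOR BOUND: on a monomial of weight `n` (i.e. `Σ a·mₐ = n`) the letter words have total cost
`≤ 7⌊√n⌋ + 7` (in fact `≤ 3⌊√n⌋ + 4`: `s·T ≤ 2n + s²` and `n < (s+1)²`). -/
theorem sum_letterCost_le_door (n : ℕ) {d : ℕ →₀ ℕ}
    (hd : Finsupp.weight (fun m : ℕ => m + 1) d = n) :
    ∑ m ∈ d.support, (if Nat.sqrt n < m + 1 then d m * ((m + 1) / Nat.sqrt n + 1)
      else d m / (Nat.sqrt n / (m + 1)) + 1) ≤ 7 * Nat.sqrt n + 7 := by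
  by_cases h0 : d = 0
  · simp [h0]
  obtain ⟨m₀, hm₀⟩ := Finset.nonempty_of_ne_empty (mt Finsupp.support_eq_empty.1 h0)
  have hn : 1 ≤ n := by
    rw [← hd]
    simp only [Finsupp.weight_apply, Finsupp.sum, smul_eq_mul]
    have hpos : 0 < d m₀ * (m₀ + 1) :=
      Nat.mul_pos (Nat.pos_of_ne_zero (Finsupp.mem_support_iff.1 hm₀)) (by omega)
    exact le_trans hpos
      (Finset.single_le_sum (f := fun x => d x * (x + 1)) (fun m _ => Nat.zero_le _) hm₀)
  have key := mul_sum_letterCost_le (Nat.sqrt n) d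
  rw [hd] at key
  obtain ⟨s, hs⟩ : ∃ s : ℕ, s = Nat.sqrt n := ⟨_, rfl⟩
  rw [← hs] at key ⊢
  have hs1 : 1 ≤ s := by rw [hs]; exact Nat.le_sqrt.2 (by simpa using hn)
  have hlt : n < (s + 1) * (s + 1) := by rw [hs]; exact Nat.lt_succ_sqrt n
  obtain ⟨T, hT⟩ : ∃ T : ℕ, T = ∑ m ∈ d.support,
      (if s < m + 1 then d m * ((m + 1) / s + 1) else d m / (s / (m + 1)) + 1) := ⟨_, rfl⟩
  rw [← hT] at key ⊢
  by_contra hc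
  rw [not_le] at hc
  have h7 : s * (7 * s + 7 + 1) ≤ s * T := Nat.mul_le_mul_left s hc
  nlinarith [h7, key, hlt, hs1]

end Summit.ValiantsHypothesis.ValiantsHypothesis.Theorems.Depth4SymWidthDoor
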